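import Summits.BirchSwinnertonDyer.BirchSwinnertonDyer.Theses.KatoDescentTamePotSupersingular
import Summits.BirchSwinnertonDyer.Rank1Residual.Additive.X4RankZeroKatoBoundTamagawaExact
import Summits.BirchSwinnertonDyer.BirchSwinnertonDyer.Theorems.KatoDescentPotSupersingularMuCoreIrrConjAOdd
import Summits.BirchSwinnertonDyer.BirchSwinnertonDyer.Theorems.AdditiveWildRankOneNonTowerOfConjA
import Literature.NumberTheory.EllipticCurves.Kato2004.EulerSystemClassNonvanishingProofs
import Literature.NumberTheory.EllipticCurves.CuspFormLFunctionAnalyticRankProofs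
import HarnessLib

/-!
# Route `KatoDescentTamePotSupersingular` (rung K8-t′, cell `bsd-potss`): the (t′) U₀-ns node `TameUpperNonsurjTower` (item 19202)
# and the U₀ parent `TameUpperDefectRankZero` (item 19982) BY NAME on the FINE road — from Kato's fine-Selmer reading (held input
# `PublishedInputKatoA161FineSelmer`), Gross–Zagier–Kolyvagin, the zeta-body inputs (held 24326) and ONE conjecture-grade statement
# «Kato's zeta class is a Λ-multiple of a p-indivisible Euler-system class» on ALL (t′) U₀-ns rows — CONDITIONAL alternative keying
# (KT twin of `KatoDescentPotSupersingularWildUpperFineRoadKatoZeta.lean`; items stay open; the planner decides)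

Seat `bsd-potss-k9-c4` g15 (courtesy for the KT lane); `--supports stmt-BirchSwinnertonDyer-19982 --as helper`; closes nothing.  HONEST
FRAMING: BSD is not proved by any of this; nothing is booked; Conjecture A / `μ = 0` are NOT proved.  Per row: the zeta statement and
Kato's zeta body give a `p`-indivisible genuine Euler-system class, g14's `μ`-core (`MuCoreIrr.…_of_irr_of_not_towerSurj_of_eulerClass`:
`p ≥ 5` via the K6 image facts, `p = 3` via the irreducible-only core) gives (A) at `(W,p)`, and the route-free reading
`UniversalToricDescentWaldspurgerFlat.missingUpperBoundAt_rankZero_of_irreducible_of_fineSelmerDual_fg` gives the upper half (`ord_p j ≥ 0`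
from `ClassO5 = ⟨p ≠ 2, Addv, SubTprime⟩`).  The parent: tower-onto rows by A161″ (`X4RankZero.missingUpperBoundAt_of_katoTam`, as in
k8t-c4's TowerSurj file), reducible rows by the U₀-red node `TameUpperReducibleDefect`, composition inlined.

References: [Kato2004Asterisque] Thm. 12.4 (3), 12.5, 13.4, 14.5 (3), Prop. 14.16 (2); [CoatesSujatha2005] Conj. A; [Lim2017FineSelmer]
§3; [BreuilConradDiamondTaylor2001] Thm. A; [Darmon2004] Thm. 3.22; [Serre1972] §2.
-/

-- the summit and its single problem are both named `BirchSwinnertonDyer` (registry layout D-0017)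
set_option linter.dupNamespace false
set_option autoImplicit false

noncomputable section

open Field WeierstrassCurve
open Literature.NumberTheory.GaloisRepresentations Literature.NumberTheory.EllipticCurves
open Literature.NumberTheory.EllipticCurves.ModularForms Literature.NumberTheory.EllipticCurves.Rank1Residual
open Literature.NumberTheory.EllipticCurves.Kato2004 Literature.NumberTheory.EllipticCurves.Kato2004.EulerSystemValues
open Summit.BirchSwinnertonDyer.Rank1Residual.Additive

namespace Summit.BirchSwinnertonDyer.BirchSwinnertonDyer.Theorems.TameUpperFineRoadKatoZeta

/-- **The (t′) U₀-ns node on the FINE road.**  `TameUpperNonsurjTower` (item 19202) from A161-fine (hypothesis (A) displayed),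
Gross–Zagier–Kolyvagin, the zeta-body inputs and the Λ-MULTIPLE zeta statement on all (t′) U₀-ns rows (binders of 19202, then the
block of the kit-v2 child `TameKatoZetaIndivisible`).  CONDITIONAL; the item is not closed by this theorem.
[cite: Kato2004Asterisque, Thm. 14.5 (3) (p. 236), Prop. 14.16 (2) (p. 244), Ex. 13.3 (p. 225), Thm. 12.5 (1) (pp. 221–222)]
[cite: CoatesSujatha2005, Conjecture A] [cite: Lim2017FineSelmer, §3] [cite: Darmon2004, Thm. 3.22] -/
theorem tameUpperNonsurjTower_of_fineReading_of_katoZetaMultiple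
    (hKatoA : rankZero_padicValNat_sha_add_padicValNat_tamagawa_le_of_additive_potGood_of_irreducible_of_fineSelmerDual_fg)
    (hGZK : rank_eq_analyticRank_of_analyticRank_le_one)
    (hIn : (exists_isNewformOf : Prop) ∧ (exists_eulerSystem_expStar_values : Prop))
    (hZns : ∀ (W : WeierstrassCurve ℚ) [W.IsElliptic] [W.IsGloballyMinimal] (p : ℕ) [Fact p.Prime], W.analyticRank = 0 → p ≠ 2 → Literature.NumberTheory.EllipticCurves.Rank1Residual.Addv W p → Summit.BirchSwinnertonDyer.Rank1Residual.Additive.SubTprime W p → W.HasIrreducibleModPGaloisRep p → ¬ (∀ n : ℕ, W.HasSurjectiveModNGaloisRep (p ^ n : ℕ)) → ∀ (hp : p ≠ 2) (κ : Literature.NumberTheory.EllipticCurves.ZpExtension ℚ p) (hκ : κ.IsCyclotomic) [ContinuousSMul ℤ_[p] (W.tateModule p)] [Module.Free ℤ_[p] (W.tateModule p)] [Module.Finite ℤ_[p] (W.tateModule p)] (γ : Field.absoluteGaloisGroup ℚ) (I : Literature.NumberTheory.EllipticCurves.Kato2004.IwasawaH1Data W p κ γ), κ.IsTopGenerator γ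 → ∀ {N : ℕ} [NeZero N] (f : CuspForm (CongruenceSubgroup.Gamma0 N) 2), Literature.NumberTheory.EllipticCurves.ModularForms.IsNewformOf W f → ∀ (ι : (m : ℕ) → (CyclotomicField m ℚ →+* ℂ)) (κ' : ℝ) (Λ' : ∀ (k : ℕ) (r : Finset (IsDedekindDomain.HeightOneSpectrum (NumberField.RingOfIntegers ℚ))), Literature.NumberTheory.GaloisRepresentations.H1 (Literature.NumberTheory.EllipticCurves.Kato2004.EulerSystemValues.tateRep W p) (Literature.NumberTheory.EllipticCurves.Kato2004.EulerSystemValues.cycSubgroup p k r) →ₗ[ℤ_[p]] TensorProduct ℚ ℚ_[p] (CyclotomicField (Literature.NumberTheory.EllipticCurves.Kato2004.EulerSystemValues.cycLevel p k r) ℚ)) (c d a : ℤ) (A : ℕ), 0 < A → Int.gcd c (6 * p * A) = 1 → Int.gcd d (6 * p * N) = 1 → ∀ (z : ∀ (k : ℕ) (r : (Literature.NumberTheory.GaloisRepresentations.cyclotomicLevelsRat p (Literature.NumberTheory.EllipticCurves.Kato2004.EulerSystemValues.badPlaces c d A N)).Ideals), Literature.NumberTheory.GaloisRepresentations.H1 (Literature.NumberTheory.EllipticCurves.Kato2004.EulerSystemValues.tateRep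 W p) ((Literature.NumberTheory.GaloisRepresentations.cyclotomicLevelsRat p (Literature.NumberTheory.EllipticCurves.Kato2004.EulerSystemValues.badPlaces c d A N)).level k r.1)) (x : ∀ (k : ℕ) (r : (Literature.NumberTheory.GaloisRepresentations.cyclotomicLevelsRat p (Literature.NumberTheory.EllipticCurves.Kato2004.EulerSystemValues.badPlaces c d A N)).Ideals), CyclotomicField (Literature.NumberTheory.EllipticCurves.Kato2004.EulerSystemValues.cycLevel p k r.1) ℚ), Literature.NumberTheory.EllipticCurves.Kato2004.ZetaBody W p f ι κ' Λ' c d a A z x → ∀ (y : I.H), (∀ n : ℕ, I.proj n y = Literature.NumberTheory.EllipticCurves.Kato2004.levelToLayer W p hκ hp (Literature.NumberTheory.EllipticCurves.Kato2004.EulerSystemValues.badPlaces c d A N) n (z (n + 1) (Literature.NumberTheory.GaloisRepresentations.cyclotomicLevelsRat p (Literature.NumberTheory.EllipticCurves.Kato2004.EulerSystemValues.badPlaces c d A N)).idealOne)) → y ≠ 0 → ∃ (s : I.H) (a : Literature.NumberTheory.EllipticCurves.IwasawaAlgebra p), Literature.NumberTheory.EllipticCurves.Kato2004.IsEulerSystemClass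 W p κ γ I s ∧ s ∉ Literature.NumberTheory.EllipticCurves.IwasawaAlgebra.augIdealP p • (⊤ : Submodule (Literature.NumberTheory.EllipticCurves.IwasawaAlgebra p) I.H) ∧ a • s = y) :
    Summit.BirchSwinnertonDyer.BirchSwinnertonDyer.Theses.KatoDescentTamePotSupersingular.TameUpperNonsurjTower := by
  intro W _ _ p _ hr hp2 hadd hT hirr hnt
  -- modularity (`exists_isNewformOf`) gives the entire continuation for every curve (`IsNewformOf.hasEntireLFunction`);
  -- inlined here (the named lemma lives in the K9 twin `WildUpperFineRoadKatoZeta`, not importable across routes)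
  have hmodL : hasEntireLFunction_rat := fun V _ => by
    haveI : NeZero (V.conductorNorm ℤ) := ⟨V.conductorNorm_pos_holds.ne'⟩
    obtain ⟨g, hg⟩ := hIn.1 V
    exact hg.hasEntireLFunction
  have hO5 : ClassO5 W p := ⟨hp2, hadd, Or.inr hT⟩
  refine UniversalToricDescentWaldspurgerFlat.missingUpperBoundAt_rankZero_of_irreducible_of_fineSelmerDual_fg p hp2 hKatoA
    hGZK hmodL W hr hadd hO5.padicValRat_j_nonneg hirr ?_
  intro κ hκ
  refine MuCoreIrr.exists_fineSelmerDualData_moduleFinite_of_irr_of_not_towerSurj_of_eulerClass W p hp2 hirr hnt κ hκ ?_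
  intro γ I hγ
  letI : ContinuousSMul ℤ_[p] (W.tateModule p) := TateModule.continuousSMul_padicInt
  haveI : Module.Free ℤ_[p] (W.tateModule p) := W.module_free_tateModule_holds p
  haveI : Module.Finite ℤ_[p] (W.tateModule p) := W.module_finite_tateModule_holds p
  haveI : NeZero (W.conductorNorm ℤ) := ⟨W.conductorNorm_pos_holds.ne'⟩
  -- modularity: the newform of `W`
  obtain ⟨f, hf⟩ := hIn.1 W
  -- Kato's zeta Euler system with values for an admissible guarded datum
  set ι : (m : ℕ) → (CyclotomicField m ℚ →+* ℂ) :=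
    fun m ↦ Classical.choice (inferInstance : Nonempty (CyclotomicField m ℚ →+* ℂ)) with hι
  obtain ⟨κ', hκ'0, Λ', hfam⟩ := hIn.2 W p hirr f hf ι
  obtain ⟨c, d, a, A, d', hA, hc, hd, hcd, hdd', hR⟩ := valueGuard_satisfiable f hf.1 hf.coeffField_eq_bot p
  obtain ⟨z, x, hbody⟩ := hfam c d a A hA hc hd
  have hne := two_mul_natAbs_ne_zero_of_guards p hA (NeZero.ne (W.conductorNorm ℤ)) hc hd
  -- the unique Λ-adic lift, a genuine Euler-system class, non-zero since `L(W,1) ≠ 0`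
  obtain ⟨y, _hyES, hy⟩ := exists_isEulerSystemClass_of_zetaBody W p hκ hp2 I f ι κ' Λ' c d a A z x hbody hne
  have hL1 : W.entireLFunction 1 ≠ 0 := (W.analyticRank_eq_zero_iff_holds hf.hasEntireLFunction).mp hr
  have hy0 : y ≠ 0 := lift_ne_zero_of_bottom_ne_zero W p hκ I hp2 (badPlaces c d A (W.conductorNorm ℤ)) hbody.1
    (zetaBody_bottom_ne_zero hbody hf hκ'0 hL1 hA d' hcd hdd' hR) hy
  -- the zeta statement on this (t′) U₀-ns row
  obtain ⟨s, _a, hsES, hs, _hsy⟩ := hZns W p hr hp2 hadd hT hirr hnt hp2 κ hκ γ I hγ f hf ι κ' Λ' c d a A hA hc hd z x hbody y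
    hy hy0
  exact ⟨s, hsES, hs⟩

/-- **The (t′) U₀ parent `TameUpperDefectRankZero` (item 19982; type = the route decl verbatim) on the FINE road**: tower-onto
irreducible rows by A161″ + GZK + modularity (`KatoTamagawaExactInputs`, route-free `X4RankZero.missingUpperBoundAt_of_katoTam`),
non-surjective irreducible rows by the node theorem above, reducible rows by the U₀-red node `TameUpperReducibleDefect`; composition
inlined.  CONDITIONAL; item 19982 is NOT closed by this theorem.
[cite: Kato2004Asterisque, Thm. 14.5 (3) (p. 236), Prop. 14.16 (2) (p. 244)] [cite: GreenbergLNM1716, §4 Prop. 4.13]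
[cite: CoatesSujatha2005, Conjecture A] -/
theorem tameUpperDefectRankZero_of_fineReading_of_katoZetaMultiple
    (hKatoA : rankZero_padicValNat_sha_add_padicValNat_tamagawa_le_of_additive_potGood_of_irreducible_of_fineSelmerDual_fg)
    (hGZK : rank_eq_analyticRank_of_analyticRank_le_one)
    (hIn : (exists_isNewformOf : Prop) ∧ (exists_eulerSystem_expStar_values : Prop))
    (hZns : ∀ (W : WeierstrassCurve ℚ) [W.IsElliptic] [W.IsGloballyMinimal] (p : ℕ) [Fact p.Prime], W.analyticRank = 0 → p ≠ 2 → Literature.NumberTheory.EllipticCurves.Rank1Residual.Addv W p → Summit.BirchSwinnertonDyer.Rank1Residual.Additive.SubTprime W p → W.HasIrreducibleModPGaloisRep p → ¬ (∀ n : ℕ, W.HasSurjectiveModNGaloisRep (p ^ n : ℕ)) → ∀ (hp : p ≠ 2) (κ : Literature.NumberTheory.EllipticCurves.ZpExtension ℚ p) (hκ : κ.IsCyclotomic) [ContinuousSMul ℤ_[p] (W.tateModule p)] [Module.Free ℤ_[p] (W.tateModule p)] [Module.Finite ℤ_[p] (W.tateModule p)] (γ : Field.absoluteGaloisGroup ℚ)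 (I : Literature.NumberTheory.EllipticCurves.Kato2004.IwasawaH1Data W p κ γ), κ.IsTopGenerator γ → ∀ {N : ℕ} [NeZero N] (f : CuspForm (CongruenceSubgroup.Gamma0 N) 2), Literature.NumberTheory.EllipticCurves.ModularForms.IsNewformOf W f → ∀ (ι : (m : ℕ) → (CyclotomicField m ℚ →+* ℂ)) (κ' : ℝ) (Λ' : ∀ (k : ℕ) (r : Finset (IsDedekindDomain.HeightOneSpectrum (NumberField.RingOfIntegers ℚ))), Literature.NumberTheory.GaloisRepresentations.H1 (Literature.NumberTheory.EllipticCurves.Kato2004.EulerSystemValues.tateRep W p) (Literature.NumberTheory.EllipticCurves.Kato2004.EulerSystemValues.cycSubgroup p k r) →ₗ[ℤ_[p]] TensorProduct ℚ ℚ_[p] (CyclotomicField (Literature.NumberTheory.EllipticCurves.Kato2004.EulerSystemValues.cycLevel p k r) ℚ)) (c d a : ℤ) (A : ℕ), 0 < A → Int.gcd c (6 * p * A) = 1 → Int.gcd d (6 * p * N) = 1 → ∀ (z : ∀ (k : ℕ) (r : (Literature.NumberTheory.GaloisRepresentations.cyclotomicLevelsRat p (Literature.NumberTheory.EllipticCurves.Kato2004.EulerSystemValues.badPlaces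 c d A N)).Ideals), Literature.NumberTheory.GaloisRepresentations.H1 (Literature.NumberTheory.EllipticCurves.Kato2004.EulerSystemValues.tateRep W p) ((Literature.NumberTheory.GaloisRepresentations.cyclotomicLevelsRat p (Literature.NumberTheory.EllipticCurves.Kato2004.EulerSystemValues.badPlaces c d A N)).level k r.1)) (x : ∀ (k : ℕ) (r : (Literature.NumberTheory.GaloisRepresentations.cyclotomicLevelsRat p (Literature.NumberTheory.EllipticCurves.Kato2004.EulerSystemValues.badPlaces c d A N)).Ideals), CyclotomicField (Literature.NumberTheory.EllipticCurves.Kato2004.EulerSystemValues.cycLevel p k r.1) ℚ), Literature.NumberTheory.EllipticCurves.Kato2004.ZetaBody W p f ι κ' Λ' c d a A z x → ∀ (y : I.H), (∀ n : ℕ, I.proj n y = Literature.NumberTheory.EllipticCurves.Kato2004.levelToLayer W p hκ hp (Literature.NumberTheory.EllipticCurves.Kato2004.EulerSystemValues.badPlaces c d A N) n (z (n + 1) (Literature.NumberTheory.GaloisRepresentations.cyclotomicLevelsRat p (Literature.NumberTheory.EllipticCurves.Kato2004.EulerSystemValues.badPlaces c d A N)).idealOne)) → y ≠ 0 → ∃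 (s : I.H) (a : Literature.NumberTheory.EllipticCurves.IwasawaAlgebra p), Literature.NumberTheory.EllipticCurves.Kato2004.IsEulerSystemClass W p κ γ I s ∧ s ∉ Literature.NumberTheory.EllipticCurves.IwasawaAlgebra.augIdealP p • (⊤ : Submodule (Literature.NumberTheory.EllipticCurves.IwasawaAlgebra p) I.H) ∧ a • s = y)
    (h₄b : Summit.BirchSwinnertonDyer.BirchSwinnertonDyer.Theses.KatoDescentTamePotSupersingular.TameUpperReducibleDefect)
    (hK : Summit.BirchSwinnertonDyer.BirchSwinnertonDyer.Theses.KatoDescentTamePotSupersingular.KatoTamagawaExactInputs) :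
    Summit.BirchSwinnertonDyer.BirchSwinnertonDyer.Theses.KatoDescentTamePotSupersingular.TameUpperDefectRankZero := by
  intro W _ _ p _ hr hp2 hadd hT hcov
  by_cases hI : W.HasIrreducibleModPGaloisRep p
  · by_cases hsurj : ∀ n : ℕ, W.HasSurjectiveModNGaloisRep (p ^ n : ℕ)
    · -- irreducible, tower onto: A161″ + GZK + modularity (route-free X4 node)
      have hO5 : ClassO5 W p := ⟨hp2, hadd, Or.inr hT⟩
      exact X4RankZero.missingUpperBoundAt_of_katoTam W p hK.1 hK.2.1 hK.2.2 hr ⟨hp2, hadd, hI⟩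
        hO5.padicValRat_j_nonneg hsurj
    · -- irreducible, tower not onto: the fine road
      exact tameUpperNonsurjTower_of_fineReading_of_katoZetaMultiple hKatoA hGZK hIn hZns W p hr hp2 hadd hT hI hsurj
  · -- reducible: the U₀-red node
    exact h₄b W p hr hp2 hadd hT hI (fun h ↦ hcov (Or.inr ⟨hI, h⟩))

end Summit.BirchSwinnertonDyer.BirchSwinnertonDyer.Theorems.TameUpperFineRoadKatoZeta

end
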